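import Literature.MathematicalPhysics.KineticTheory.HardSphereHierarchyModel
import Literature.MathematicalPhysics.KineticTheory.HardSphereBBGKYProofs
import Literature.MathematicalPhysics.KineticTheory.Sweep1EmpiricalProofs
import Literature.Analysis.FluidPDE.BoltzmannHierarchySeries
import HarnessLib

/-!
# The grand-canonical BBGKY hierarchy of hard spheres on `T^d` and the uniform bounds of its
# Duhamel terms (Lanford's theorem, the BBGKY side: objects and a priori estimates)

(Topic MathematicalPhysics/KineticTheory; layer L3 of the bottom-up proof plan of the named fact
`Literature.MathematicalPhysics.KineticTheory.lanford` — **hilbert6.S02**, Lanford's theorem for hard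
spheres on `T^d`, `Literature/MathematicalPhysics/KineticTheory/Sweep1.lean`; it serves the
hypothesis of the proved reduction `lanford_of_bbgkySide` (`LanfordAssembly`). Definitions with
bodies and theorems; no named fact.)

In the grand-canonical formalism of the statement of `lanford` (Gibbs-type data `gcInitial` with
activity `μ_ε`, `μ_ε ε^{d-1} = 1`, `bgActivity`; BGSS 2023 §1.1; GST 2013 §6.1 is the canonical
twin) the rescaled correlation functions `F^{(s)}_ε(t)` (`Kinetic.correlationFn`) formally satisfy
the **grand-canonical BBGKY hierarchy**
`∂_t F^{(s)} + V_s · ∇ F^{(s)} = μ_ε ε^{d-1} ∑_{i ≤ s} C^i_{s,s+1} F^{(s+1)} = ∑_{i ≤ s} C^i_{s,s+1} F^{(s+1)}`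
(BGSS 2023 (1.1.7)–(1.1.8); the canonical operator of GST (4.3.5) carries `(N - s) ε^{d-1}` instead,
`Kinetic.bbgkyOp`): summing the `N`-particle hierarchies over the sectors `N = s + p` with the
weights `μ^{-s}/p!` of `correlationFn` turns the prefactors `(N - s)` into the activity `μ`
(`∑_p (p!)⁻¹ (s + p - s) f_{s+p}^{(s+1)} = μ^{s+1} F^{(s+1)}`). Its iterated Duhamel formula
`F^{(s)}(t) = ∑_n Q^ε_{s,s+n}(t) F(0)` is the BBGKY series (4.7) of Cercignani–Illner–Pulvirenti 1994
in grand-canonical form, and Step 3 of the proof of their Thm 4.4.1 ((4.16)–(4.18), pp. 83–85;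
GST 2013 Thm 6, the uniform bound for the BBGKY hierarchy in the spaces `X_{ε,β,μ}`) bounds its
terms by a geometric series on a time interval depending only on `(d, β₀, C₀)`.

This file builds these objects in the tree's abstract hierarchy framework
(`Kinetic.HierarchyModel` of `HierarchyDuhamelBlocks`: transports by jointly measurable
energy-preserving maps, collision operators with the single-step weighted estimate), following the
design of the hard-sphere model `hsHierarchyModel` of `HardSphereHierarchyModel` (BGSR programme):

* `gcOutOp G ε s` (§1) — the grand-canonical collision operator `∑_{i ≤ s} C^i_{s,s+1}` (unit
  prefactor: `μ_ε ε^{d-1} = 1` built in) with its argument read, in the `i`-th term, at the outgoing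
  representative `outRep i` of the contact configuration (for a function satisfying the boundary
  identification `g(Z) = g(Z^*)` of CIP 1994 (4.3.4) this is the plain operator,
  `gcOutOp_eq_of_boundary`); `outBbgkyOp G ε N s = ((N - s) ε^{d-1}) • gcOutOp G ε s`
  (`outBbgkyOp_eq_smul_gcOutOp`). Additivity on the Lanford class, homogeneity, parametrised
  measurability, the weighted estimate with the `ε`-INDEPENDENT constant `C_d = J_d |S^{d-1}|`
  (`abs_gcOutOp_le_weighted`), vanishing off the hard-sphere domains.
* `gcHierarchyModel hε'` (§2) — the grand-canonical BBGKY hierarchy of hard spheres of diameter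
  `ε < 1/2` on `T^d` as a `HierarchyModel`: transports along the regularised Alexander flows
  `Alexander.regFlow` of every particle number (groups on the whole phase space, equal to the
  hard-sphere flow on its conull good set), collision operators `gcOutOp`, `opConst = C_d`.
* `lanfordGCData ε f₀` (§3) — the initial rescaled correlation functions
  `F^{(s)}_ε(0) = correlationFn μ_ε (gcInitial ε μ_ε f₀) s` as a family, and their membership in the
  Lanford class: measurable (`measurable_correlationFn_gcInitial`: a countable series of marginals)
  with `0 ≤ F^{(s)}_ε(0) ≤ C₀^s e^{-β₀ E}` (`correlationFn_gcInitial_bound_holds`).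
* `lanfordGCTerm hε' f₀ n s t` (§4) — **the Duhamel terms `Q^ε_{s,s+n}(t) F_ε(0)` of the
  grand-canonical BBGKY hierarchy** (the candidates for the functions `A_k^{(s),n}(t)` of
  `lanford_of_bbgkySide` at `ε = ε_k`), their measurability (`measurable_lanfordGCTerm`) and **the
  uniform a priori bound** (`abs_lanfordGCTerm_le`): for `0 ≤ t` with `2 C'_d N t ≤ (√β₀)^{d+1}`,
  `N = max(C₀, 1)`, `C'_d = e² (√2)^{d+3} C_d + 1`,
  `|Q^ε_{s,s+n}(t) F_ε(0) (Z_s)| ≤ (1 + e^{s-1}) N^s 2^{-n} e^{-(β₀/2) E(Z_s)}` — uniformly in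
  `ε ∈ (0, 1/2)` (CIP 1994 Thm 4.4.1 Step 3; the chain estimate `abs_hierarchyChain_le` of
  `BoltzmannHierarchySeries` for the model, whose constant does not see `ε`). Packaged for the
  reduction in `exists_time_forall_abs_lanfordGCTerm_le` (a time `T_B(d, β₀, C₀) > 0` and the
  majorants `M_s rⁿ e^{-β E}` with `r = 1/2`, `β = β₀/2`, for every Lanford datum and every `ε`).

What is NOT here (the remaining BBGKY-side inputs of `lanford_of_bbgkySide`): the identification
`∑_n Q^ε_{s,s+n}(t) F_ε(0) = F^{(s)}_ε(t)` almost everywhere with the correlation functions of the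
evolved state `gcEvolved` (the rigorous grand-canonical BBGKY hierarchy and its iteration, CIP 1994
Thm 4.3.1 and (4.7), App. 4.A–4.B; Illner–Pulvirenti 1987; Spohn 2006; it needs the physical a.e.
hierarchy with canonical boundary values, `Literature.Analysis.FluidPDE.MildBBGKYae`, which the
discharged `liouville_imp_bbgky` does not provide — see the honesty note of
`HardSphereBBGKYLiouvilleHolds`), and the term-by-term convergence (GST 2013 Part III).

## References

* C. Cercignani, R. Illner, M. Pulvirenti, *The Mathematical Theory of Dilute Gases*, Applied
  Mathematical Sciences 106, Springer (1994), §4.3 (4.3.4), Thm 4.3.1, §4.4 (4.7) and Thm 4.4.1,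
  proof, Step 3, (4.16)–(4.18), pp. 74–77, 83–85 (held:
  `lit read book:cercignani1994-mathematical-theory-dilute-gases`, PDF pp. 82–85, 91–93; bib key
  `CIP1994` / `CercignaniIllnerPulvirenti1994`).
* I. Gallagher, L. Saint-Raymond, B. Texier, *From Newton to Boltzmann: hard spheres and short-range
  potentials*, EMS ZLAM (2013) = arXiv:1208.5753 (held text): (4.3.5)–(4.3.9), §6.1, Thm 6 (p. 25)
  (bib key `GST2013`).
* T. Bodineau, I. Gallagher, L. Saint-Raymond, S. Simonella, *Statistical dynamics of a hard sphere
  gas: fluctuating Boltzmann equation and large deviations*, Ann. Math. 198 (2023) = arXiv:2008.10403,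
  §1.1 (1.1.4)–(1.1.8) (the grand-canonical hierarchy; bib key `BGSS2023`).
* T. Bodineau, I. Gallagher, L. Saint-Raymond, Invent. Math. 203 (2016) = arXiv:1305.3397v2, §3.1
  (collision operators read at pre- and post-collisional configurations), §4.2 Lemma 4.2.
-/

open MeasureTheory Metric Real Set Filter Topology Function
open scoped ENNReal Nat NNReal

namespace Literature.MathematicalPhysics.KineticTheory

noncomputable section

open Literature.Analysis.FluidPDE

variable {d : Type*} [Fintype d]

/-! ## §1. The grand-canonical collision operator read at outgoing representatives -/

section GcOp

variable {X : Type*} (G : Geometry d X) (ε : ℝ)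

/-- **The grand-canonical BBGKY collision operator read at outgoing representatives**:
`(C^{gc,out}_{s,s+1} g)(Z_s) = ∑_{i ≤ s} C^i_{s,s+1}[g ∘ outRep i](Z_s)` — the operator
`μ_ε ε^{d-1} ∑_i C^i_{s,s+1}` of the grand-canonical hierarchy (BGSS 2023 (1.1.7)–(1.1.8)) in the
Boltzmann–Grad scaling `μ_ε ε^{d-1} = 1` (unit prefactor), each evaluation of the argument moved
to the post-collisional partner as in `outBbgkyOp` (BGSR §3.1; CIP 1994 (4.3.4)). [cite: BGSS2023, (1.1.7)–(1.1.8)] -/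
def gcOutOp (s : ℕ) (g : Config (s + 1) d X → ℝ) (Zs : Config s d X) : ℝ :=
  ∑ i : Fin s, hsCollisionTerm G ε s i (g ∘ outRep G s i) Zs

variable {G ε}

/-- **The canonical outgoing operator is a multiple of the grand-canonical one**:
`C^{out}_{s,s+1} = ((N - s) ε^{d-1}) • C^{gc,out}_{s,s+1}` (GST (4.3.5) versus BGSS (1.1.8)).
[folklore] -/
theorem outBbgkyOp_eq_smul_gcOutOp (N s : ℕ) (g : Config (s + 1) d X → ℝ) :
    outBbgkyOp G ε N s g = (((N - s : ℕ) : ℝ) * ε ^ (Fintype.card d - 1)) • gcOutOp G ε s g := by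
  funext Zs
  simp only [outBbgkyOp, gcOutOp, bbgkyCollisionOp, Pi.smul_apply, smul_eq_mul, Finset.mul_sum]

/-- If `g` takes the same value at a configuration and at its outgoing representative for every
pair `(i, s+1)` (the boundary identification of CIP 1994 (4.3.4)), the outgoing reading is the
plain grand-canonical operator `∑_i C^i_{s,s+1} g`. [cite: CIP1994, §4.3 (4.3.4)] -/
theorem gcOutOp_eq_of_boundary (s : ℕ) {g : Config (s + 1) d X → ℝ}
    (hg : ∀ (i : Fin s) (Z : Config (s + 1) d X), g (outRep G s i Z) = g Z) (Zs : Config s d X) :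
    gcOutOp G ε s g Zs = ∑ i : Fin s, hsCollisionTerm G ε s i g Zs := by
  unfold gcOutOp
  refine Finset.sum_congr rfl fun i _ => ?_
  have : g ∘ outRep G s i = g := funext fun Z => hg i Z
  rw [this]

/-- Homogeneity of the grand-canonical outgoing operator. [folklore] -/
theorem gcOutOp_smul (s : ℕ) (c : ℝ) (g : Config (s + 1) d X → ℝ) :
    gcOutOp G ε s (c • g) = c • gcOutOp G ε s g := by
  funext Zs
  simp only [gcOutOp, Pi.smul_apply, smul_eq_mul, Finset.mul_sum]
  refine Finset.sum_congr rfl fun i _ => ?_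
  have : (c • g) ∘ outRep G s i = c • (g ∘ outRep G s i) := rfl
  rw [this, hsCollisionTerm_smul]

/-- At level `0` the operator is an empty sum. [folklore] -/
@[simp]
theorem gcOutOp_level_zero (g : Config 1 d X → ℝ) (Z : Config 0 d X) : gcOutOp G ε 0 g Z = 0 := by
  simp [gcOutOp]

variable [MeasurableSpace X]

/-- **Additivity of the grand-canonical outgoing operator** on finite sums of nice densities
(`hsCollisionTerm_finset_sum` applied to the compositions with the outgoing representatives).
[folklore] -/
theorem gcOutOp_finset_sum (hGm : G.IsMeasurable) (s : ℕ) {ι : Type*} (S : Finset ι)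
    {g : ι → Config (s + 1) d X → ℝ} (hg : ∀ n ∈ S, IsNice (g n)) :
    gcOutOp G ε s (∑ n ∈ S, g n) = ∑ n ∈ S, gcOutOp G ε s (g n) := by
  funext Zs
  simp only [Finset.sum_apply, gcOutOp]
  rw [Finset.sum_comm]
  refine Finset.sum_congr rfl fun i _ => ?_
  have hcomp : (∑ n ∈ S, g n) ∘ outRep G s i = ∑ n ∈ S, (g n ∘ outRep G s i) := by
    funext Z
    simp [Finset.sum_apply]
  rw [hcomp, hsCollisionTerm_finset_sum hGm.measurable_translate ε i S
    (fun n hn => ((hg n hn).comp_outRep hGm i).1) (fun n hn => ((hg n hn).comp_outRep hGm i).2) Zs]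

/-- The grand-canonical outgoing operator of a measurably parametrised density is jointly
measurable in the parameter and the configuration. [folklore] -/
theorem measurable_gcOutOp_param (hGm : G.IsMeasurable) (s : ℕ) {α : Type*} [MeasurableSpace α]
    {u : α × Config (s + 1) d X → ℝ} (hu : Measurable u) :
    Measurable fun p : α × Config s d X => gcOutOp G ε s (fun Z => u (p.1, Z)) p.2 := by
  unfold gcOutOp
  refine Finset.measurable_sum _ fun i _ => ?_
  have hu' : Measurable fun q : α × Config (s + 1) d X => u (q.1, outRep G s i q.2) :=
    hu.comp (measurable_fst.prodMk ((measurable_outRep hGm s i).comp measurable_snd))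
  exact measurable_hsCollisionTerm_param hGm.measurable_translate ε i hu'

omit [MeasurableSpace X] in
/-- **The single-step weighted estimate for the grand-canonical outgoing operator**, with an
`ε`-independent constant: if `|g| ≤ K e^{-λ H_{k+1}}` then
`|C^{gc,out}_{k,k+1} g (Z_k)| ≤ C_d λ^{-d/2} (k λ^{-1/2} + ∑_{i<k} |v_i|) K e^{-λ H_k(Z_k)}`,
`C_d = J_d |S^{d-1}|` (`abs_hsCollisionTerm_le_weighted`, the compositions `g ∘ outRep i` obeying
the same Gaussian bound; CIP 1994 (4.16); BGSR (4.11) without the prefactor `N ε^{d-1}`).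
[cite: CIP1994, §4.4 (4.16)] -/
theorem abs_gcOutOp_le_weighted (ε : ℝ) (s : ℕ) {K b : ℝ} (hb : 0 < b)
    {g : Config (s + 1) d X → ℝ} (hg : ∀ Z, |g Z| ≤ K * exp (-b * configEnergy Z))
    (Zs : Config s d X) :
    |gcOutOp G ε s g Zs| ≤
      ((∫ u : EuclideanSpace ℝ d, (1 + ‖u‖) * exp (-(1 / 2) * ‖u‖ ^ 2)) *
          (KineticTheory.sphereMeasure : Measure (sphere (0 : EuclideanSpace ℝ d) 1)).real univ) *
        (sqrt b ^ Fintype.card d)⁻¹ * (s * (sqrt b)⁻¹ + ∑ i, ‖(Zs i).2‖) *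
        (K * exp (-b * configEnergy Zs)) := by
  set C := (∫ u : EuclideanSpace ℝ d, (1 + ‖u‖) * exp (-(1 / 2) * ‖u‖ ^ 2)) *
    (KineticTheory.sphereMeasure : Measure (sphere (0 : EuclideanSpace ℝ d) 1)).real univ with hC
  unfold gcOutOp
  calc |∑ i : Fin s, hsCollisionTerm G ε s i (g ∘ outRep G s i) Zs|
      ≤ ∑ i : Fin s, |hsCollisionTerm G ε s i (g ∘ outRep G s i) Zs| := Finset.abs_sum_le_sum_abs _ _
    _ ≤ ∑ i : Fin s, C * (sqrt b ^ Fintype.card d)⁻¹ * ((sqrt b)⁻¹ + ‖(Zs i).2‖) *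
          (K * exp (-b * configEnergy Zs)) :=
        Finset.sum_le_sum fun i _ => abs_hsCollisionTerm_le_weighted G ε i hb (abs_comp_outRep_le i hg) Zs
    _ = _ := by
        rw [← Finset.sum_mul, ← Finset.mul_sum, Finset.sum_add_distrib, Finset.sum_const,
          Finset.card_univ, Fintype.card_fin, nsmul_eq_mul]

omit [MeasurableSpace X] in
/-- **The grand-canonical outgoing operator of a function vanishing off `D_ε^{s+1}` vanishes off
`D_ε^s`** (as `outBbgkyOp_eq_zero_of_not_mem`). [folklore] -/
theorem gcOutOp_eq_zero_of_not_mem {s : ℕ} {g : Config (s + 1) d X → ℝ}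
    (hg : ∀ Z ∉ hardSphereDomain G (s + 1) ε, g Z = 0) {Zs : Config s d X}
    (hZs : Zs ∉ hardSphereDomain G s ε) : gcOutOp G ε s g Zs = 0 := by
  have h1 : ∀ (i : Fin s) (ω v : EuclideanSpace ℝ d), g (outRep G s i (gainConfig G ε Zs i ω v)) = 0 :=
    fun i ω v => hg _ (mt (outRep_mem_hardSphereDomain_iff i _).1
      (gainConfig_not_mem_hardSphereDomain hZs i ω v))
  have h2 : ∀ (i : Fin s) (ω v : EuclideanSpace ℝ d), g (outRep G s i (lossConfig G ε Zs i ω v)) = 0 :=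
    fun i ω v => hg _ (mt (outRep_mem_hardSphereDomain_iff i _).1
      (lossConfig_not_mem_hardSphereDomain hZs i ω v))
  simp [gcOutOp, hsCollisionTerm, Function.comp_apply, h1, h2]

end GcOp

/-! ## §2. The grand-canonical BBGKY hierarchy on the torus as a `HierarchyModel` -/

section Model


/-- **The grand-canonical BBGKY hierarchy of hard spheres of diameter `ε` on `T^d` as a
`HierarchyModel`** (`ε < 1/2`; the group property of the transports needs `0 < ε`): transports along the regularised Alexander flows of every
particle number (`Alexander.regFlow`: groups on the whole phase space, jointly measurable,
energy-preserving, equal to the hard-sphere flow on its conull good set and to the identity off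
it), collision operators `C^{gc,out}_{s,s+1}` (`gcOutOp`), constant `opConst = C_d = J_d |S^{d-1}|`
independent of `ε`. Its Duhamel terms applied to the initial correlation functions are the terms of
the BBGKY series (4.7) of CIP 1994 in grand-canonical form. [cite: CIP1994, §4.4 (4.7)] -/
def gcHierarchyModel {ε : ℝ} (hε' : ε < 2⁻¹) : HierarchyModel d (UnitAddTorus d) where
  flow := fun s t => Alexander.regFlow (N := s) (Torus.geometry d) ε t
  op := gcOutOp (Torus.geometry d) ε
  opConst := (∫ u : EuclideanSpace ℝ d, (1 + ‖u‖) * exp (-(1 / 2) * ‖u‖ ^ 2)) *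
    (KineticTheory.sphereMeasure : Measure (sphere (0 : EuclideanSpace ℝ d) 1)).real univ
  configEnergy_flow := fun s t Z => Alexander.configEnergy_regFlow t Z
  measurable_flow := fun s => Alexander.measurable_regFlow_uncurry hε'
  measurable_op := fun s u hu => measurable_gcOutOp_param Torus.isMeasurable_geometry s hu
  op_add := fun s g₁ g₂ h₁ h₂ => by
    have h := gcOutOp_finset_sum (ε := ε) Torus.isMeasurable_geometry s
      (Finset.univ : Finset Bool) (g := fun b => bif b then g₁ else g₂)
      (fun b _ => by cases b <;> simp only [cond_true, cond_false] <;> first | exact h₁ | exact h₂)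
    simpa [Fintype.sum_bool] using h
  op_smul := fun s c g => gcOutOp_smul s c g
  opConst_nonneg := by
    haveI := isFiniteMeasure_sphereMeasure (E := EuclideanSpace ℝ d)
    have hJ : 0 ≤ ∫ u : EuclideanSpace ℝ d, (1 + ‖u‖) * exp (-(1 / 2) * ‖u‖ ^ 2) :=
      integral_nonneg fun u => by positivity
    exact mul_nonneg hJ measureReal_nonneg
  op_weighted := fun k g K b hb _ hg Z => abs_gcOutOp_le_weighted ε k hb hg Z

variable {ε : ℝ} (hε' : ε < 2⁻¹)

/-- The flows of the grand-canonical model are the regularised Alexander flows. [folklore] -/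
@[simp]
theorem gcHierarchyModel_flow (s : ℕ) (t : ℝ) :
    (gcHierarchyModel (d := d) hε').flow s t = Alexander.regFlow (Torus.geometry d) ε t := rfl

/-- The collision operators of the grand-canonical model are the grand-canonical outgoing
operators. [folklore] -/
@[simp]
theorem gcHierarchyModel_op (s : ℕ) (g : Config (s + 1) d (UnitAddTorus d) → ℝ) :
    (gcHierarchyModel (d := d) hε').op s g = gcOutOp (Torus.geometry d) ε s g := rfl

/-- The constant of the grand-canonical model is `C_d`, independent of `ε`. [folklore] -/
theorem gcHierarchyModel_opConst :
    (gcHierarchyModel (d := d) hε').opConst =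
      (∫ u : EuclideanSpace ℝ d, (1 + ‖u‖) * exp (-(1 / 2) * ‖u‖ ^ 2)) *
        (KineticTheory.sphereMeasure : Measure (sphere (0 : EuclideanSpace ℝ d) 1)).real univ := rfl

/-- The transports of the grand-canonical model, unfolded. [folklore] -/
theorem gcHierarchyModel_transport_apply (s : ℕ) (t : ℝ) (g : Config s d (UnitAddTorus d) → ℝ) (Z : Config s d (UnitAddTorus d)) :
    (gcHierarchyModel (d := d) hε').transport s t g Z =
      g (Alexander.regFlow (Torus.geometry d) ε (-t) Z) := rfl

/-- **The transports of the grand-canonical model form groups on the whole phase space**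
(`Alexander.regFlow_add`). [folklore] -/
theorem gcHierarchyModel_flow_add (hε : 0 < ε) (s : ℕ) (a b : ℝ) (Z : Config s d (UnitAddTorus d)) :
    (gcHierarchyModel (d := d) hε').flow s (a + b) Z =
      (gcHierarchyModel hε').flow s a ((gcHierarchyModel hε').flow s b Z) :=
  Alexander.regFlow_add hε hε' a b Z

/-- The transports of the grand-canonical model at time `0` are the identity. [folklore] -/
theorem gcHierarchyModel_flow_zero (hε : 0 < ε) (s : ℕ) (Z : Config s d (UnitAddTorus d)) :
    (gcHierarchyModel (d := d) hε').flow s 0 Z = Z :=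
  Alexander.regFlow_zero hε hε' Z

/-- Off the hard-sphere domain the transports of the model fix the configuration. [folklore] -/
theorem gcHierarchyModel_flow_of_not_mem {s : ℕ} {Z : Config s d (UnitAddTorus d)}
    (hZ : Z ∉ hardSphereDomain (Torus.geometry d) s ε) (t : ℝ) :
    (gcHierarchyModel (d := d) hε').flow s t Z = Z :=
  Alexander.regFlow_of_not_mem (fun h => hZ (Alexander.good_subset_hardSphereDomain h)) t

/-- **Duhamel terms of data vanishing off the hard-sphere domains vanish off the hard-sphere
domains**, at every level and order (as `duhamelTerm_hsHierarchyModel_eq_zero_of_not_mem`).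
[folklore] -/
theorem duhamelTerm_gcHierarchyModel_eq_zero_of_not_mem {F₀ : GCState d (UnitAddTorus d)}
    (hF₀ : ∀ (k : ℕ), ∀ Z ∉ hardSphereDomain (Torus.geometry d) k ε, F₀ k Z = 0)
    (n : ℕ) : ∀ (s : ℕ) (t : ℝ), ∀ Z ∉ hardSphereDomain (Torus.geometry d) s ε,
      duhamelTerm (gcHierarchyModel (d := d) hε').transport (gcHierarchyModel hε').op n s t F₀ Z = 0 := by
  induction n with
  | zero =>
    intro s t Z hZ
    rw [duhamelTerm_zero, HierarchyModel.transport_apply, gcHierarchyModel_flow_of_not_mem hε' hZ]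
    exact hF₀ s Z hZ
  | succ n ih =>
    intro s t Z hZ
    rw [duhamelTerm_succ]
    refine intervalIntegral.integral_zero_ae (Eventually.of_forall fun τ _ => ?_)
    rw [HierarchyModel.transport_apply, gcHierarchyModel_flow_of_not_mem hε' hZ, gcHierarchyModel_op]
    exact gcOutOp_eq_zero_of_not_mem (fun Z' hZ' => ih (s + 1) τ Z' hZ') hZ

end Model

/-! ## §3. The initial correlation functions as a family in the Lanford class -/

section Data



/-- Each sector of the grand-canonical Gibbs-type state of a measurable `f₀` on `T^d` is
measurable. [folklore] -/
theorem measurable_gcInitial_torus (ε μ : ℝ) {f₀ : UnitAddTorus d × EuclideanSpace ℝ d → ℝ} (hf₀m : Measurable f₀) (N : ℕ) :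
    Measurable (gcInitial (Torus.geometry d) ε μ f₀ N) := by
  unfold gcInitial
  exact ((measurable_tensorPow hf₀m N).indicator (measurableSet_hardSphereDomain_torus N ε)).const_mul _

/-- **The rescaled correlation functions of the grand-canonical Gibbs-type state of a measurable
`f₀` are measurable**: each term `(p!)⁻¹ ∫ W_{s+p}(Z_s, Z_p) dZ_p` is a measurable function of `Z_s`
(`measurable_marginal`, measurability of parametric Bochner integrals), and a countable series of
measurable real functions is measurable (`Measurable.tsum`, junk value included). [folklore] -/
theorem measurable_correlationFn_gcInitial (ε μ : ℝ) {f₀ : UnitAddTorus d × EuclideanSpace ℝ d → ℝ} (hf₀m : Measurable f₀) (s : ℕ) :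
    Measurable (correlationFn μ (gcInitial (Torus.geometry d) ε μ f₀) s) := by
  have ham : ∀ p : ℕ, Measurable fun Zs : Config s d (UnitAddTorus d) =>
      (p ! : ℝ)⁻¹ * marginal s p (gcInitial (Torus.geometry d) ε μ f₀ (s + p)) Zs := fun p =>
    (measurable_marginal s p (measurable_gcInitial_torus ε μ hf₀m (s + p))).const_mul _
  have hsum : Measurable fun Zs : Config s d (UnitAddTorus d) =>
      ∑' p : ℕ, (p ! : ℝ)⁻¹ * marginal s p (gcInitial (Torus.geometry d) ε μ f₀ (s + p)) Zs :=
    Measurable.tsum ham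
  exact hsum.const_mul _

/-- **The initial rescaled correlation functions of Lanford's theorem**, as a family:
`F^{(s)}_ε(0) = correlationFn μ_ε (gcInitial ε μ_ε f₀) s` with the Boltzmann–Grad activity
`μ_ε = ε^{-(d-1)}` (`bgActivity`) — the data fed to the Duhamel terms of the grand-canonical
hierarchy (CIP 1994 (4.7): the series involves "only the functions `P₀^{(r)}` for `r ≥ s`";
BGSS 2023 (1.1.6)). [cite: CIP1994, §4.4 (4.7)] -/
def lanfordGCData (ε : ℝ) (f₀ : UnitAddTorus d × EuclideanSpace ℝ d → ℝ) : GCState d (UnitAddTorus d) :=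
  fun s => correlationFn (bgActivity d ε) (gcInitial (Torus.geometry d) ε (bgActivity d ε) f₀) s

/-- Unfolding lemma for the data. [folklore] -/
theorem lanfordGCData_apply (ε : ℝ) (f₀ : UnitAddTorus d × EuclideanSpace ℝ d → ℝ) (s : ℕ) :
    lanfordGCData (d := d) ε f₀ s =
      correlationFn (bgActivity d ε) (gcInitial (Torus.geometry d) ε (bgActivity d ε) f₀) s := rfl

/-- The Boltzmann–Grad activity is nonnegative for `ε ≥ 0`. [folklore] -/
theorem bgActivity_nonneg {ε : ℝ} (hε : 0 ≤ ε) : 0 ≤ bgActivity d ε := by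
  unfold bgActivity
  positivity

/-- **The data are in the Lanford class**: for `0 ≤ f₀ ≤ C₀ e^{-β₀|v|²/2}` measurable (`β₀ > 0`,
`ε ≥ 0`), each `F^{(s)}_ε(0)` is measurable and `0 ≤ F^{(s)}_ε(0) ≤ C₀^s e^{-β₀ E}`
(`correlationFn_gcInitial_bound_holds`: `1_{D^{s+p}} ≤ 1_{D^s} ⊗ 1_{D^p}`, GST 2013 Prop. 6.1.1
shape). [cite: GST2013, Prop. 6.1.1 (shape)] -/
theorem lanfordGCData_nice {ε β₀ C₀ : ℝ} (hε : 0 ≤ ε) (hβ₀ : 0 < β₀) {f₀ : UnitAddTorus d × EuclideanSpace ℝ d → ℝ}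
    (hf₀m : Measurable f₀) (hf₀ : 0 ≤ f₀) (hf₀b : ∀ z, f₀ z ≤ C₀ * exp (-(β₀ / 2) * ‖z.2‖ ^ 2))
    (s : ℕ) :
    Measurable (lanfordGCData (d := d) ε f₀ s) ∧
      ∀ Zs, 0 ≤ lanfordGCData (d := d) ε f₀ s Zs ∧
        lanfordGCData (d := d) ε f₀ s Zs ≤ C₀ ^ s * exp (-β₀ * configEnergy Zs) := by
  have hμ : 0 ≤ bgActivity d ε := bgActivity_nonneg hε
  have hf₀i : Integrable f₀ := by
    refine LanfordEmpirical.integrable_of_le_maxwellianBeta (C := C₀ * (2 * Real.pi * β₀⁻¹) ^ ((Module.finrank ℝ (EuclideanSpace ℝ d) : ℝ) / 2))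
      hβ₀ hf₀m hf₀ fun z => ?_
    have h := hf₀b z
    rw [LanfordEmpirical.exp_neg_eq_mul_maxwellianBeta hβ₀, ← mul_assoc] at h
    exact h
  refine ⟨measurable_correlationFn_gcInitial ε _ hf₀m s, fun Zs => ?_⟩
  exact correlationFn_gcInitial_bound_holds (Torus.measurable_geometry_sepVec (d := d)) ε hμ hf₀ hf₀i
    (fun x v => hf₀b (x, v)) s Zs

/-- The data are nice families (`Kinetic.IsNice` at every level). [folklore] -/
theorem isNice_lanfordGCData {ε β₀ C₀ : ℝ} (hε : 0 ≤ ε) (hβ₀ : 0 < β₀) {f₀ : UnitAddTorus d × EuclideanSpace ℝ d → ℝ}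
    (hf₀m : Measurable f₀) (hf₀ : 0 ≤ f₀) (hf₀b : ∀ z, f₀ z ≤ C₀ * exp (-(β₀ / 2) * ‖z.2‖ ^ 2))
    (s : ℕ) : IsNice (lanfordGCData (d := d) ε f₀ s) := by
  obtain ⟨hm, hb⟩ := lanfordGCData_nice hε hβ₀ hf₀m hf₀ hf₀b s
  refine ⟨hm, C₀ ^ s, β₀, hβ₀, fun Zs => ?_⟩
  rw [abs_of_nonneg (hb Zs).1]
  exact (hb Zs).2

/-- The data vanish off the hard-sphere domains (`correlationFn_gcInitial_le_holds`:
`F^{(s)} ≤ 1_{D_ε^s} f₀^{⊗s}`). [folklore] -/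
theorem lanfordGCData_eq_zero_of_not_mem {ε β₀ C₀ : ℝ} (hε : 0 ≤ ε) (hβ₀ : 0 < β₀)
    {f₀ : UnitAddTorus d × EuclideanSpace ℝ d → ℝ} (hf₀m : Measurable f₀) (hf₀ : 0 ≤ f₀)
    (hf₀b : ∀ z, f₀ z ≤ C₀ * exp (-(β₀ / 2) * ‖z.2‖ ^ 2)) (s : ℕ) {Zs : Config s d (UnitAddTorus d)}
    (hZs : Zs ∉ hardSphereDomain (Torus.geometry d) s ε) : lanfordGCData (d := d) ε f₀ s Zs = 0 := by
  have hμ : 0 ≤ bgActivity d ε := bgActivity_nonneg hε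
  have hf₀i : Integrable f₀ := by
    refine LanfordEmpirical.integrable_of_le_maxwellianBeta (C := C₀ * (2 * Real.pi * β₀⁻¹) ^ ((Module.finrank ℝ (EuclideanSpace ℝ d) : ℝ) / 2))
      hβ₀ hf₀m hf₀ fun z => ?_
    have h := hf₀b z
    rw [LanfordEmpirical.exp_neg_eq_mul_maxwellianBeta hβ₀, ← mul_assoc] at h
    exact h
  refine le_antisymm ?_ (correlationFn_gcInitial_nonneg_holds (Torus.geometry d) ε hμ hf₀ hf₀i s Zs)
  have h := correlationFn_gcInitial_le_holds (Torus.measurable_geometry_sepVec (d := d)) ε hμ hf₀ hf₀i s Zs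
  rwa [indicator_of_notMem hZs] at h

end Data

/-! ## §4. The Duhamel terms of the grand-canonical hierarchy and their uniform bounds -/

section Terms


variable {ε : ℝ} (hε' : ε < 2⁻¹)

/-- **The Duhamel terms of the grand-canonical BBGKY hierarchy of Lanford's theorem**:
`Q^ε_{s,s+n}(t) F_ε(0) (Z_s)`, the `n`-th iterated Duhamel term of the model `gcHierarchyModel`
applied to the initial correlation functions `lanfordGCData ε f₀` — the `n`-th term of the BBGKY
series (4.7) of CIP 1994 in grand-canonical form (regularised flows, outgoing reading). These are
the candidates for the functions `A_k^{(s),n}(t)` (`ε = ε_k`) of the reduction `lanford_of_bbgkySide`.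
[cite: CIP1994, §4.4 (4.7)] -/
def lanfordGCTerm (f₀ : UnitAddTorus d × EuclideanSpace ℝ d → ℝ) (n s : ℕ) (t : ℝ) : Config s d (UnitAddTorus d) → ℝ :=
  duhamelTerm (gcHierarchyModel (d := d) hε').transport (gcHierarchyModel hε').op n s t
    (lanfordGCData ε f₀)

/-- Unfolding lemma. [folklore] -/
theorem lanfordGCTerm_def (f₀ : UnitAddTorus d × EuclideanSpace ℝ d → ℝ) (n s : ℕ) (t : ℝ) :
    lanfordGCTerm (d := d) hε' f₀ n s t =
      duhamelTerm (gcHierarchyModel (d := d) hε').transport (gcHierarchyModel hε').op n s t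
        (lanfordGCData ε f₀) := rfl

/-- The order-`0` term is the transported datum `F^{(s)}_ε(0) ∘ Φ^s_{-t}` (regularised flow).
[folklore] -/
theorem lanfordGCTerm_zero (f₀ : UnitAddTorus d × EuclideanSpace ℝ d → ℝ) (s : ℕ) (t : ℝ) (Z : Config s d (UnitAddTorus d)) :
    lanfordGCTerm (d := d) hε' f₀ 0 s t Z =
      lanfordGCData ε f₀ s (Alexander.regFlow (Torus.geometry d) ε (-t) Z) := rfl

/-- The Duhamel recursion of the terms:
`Q_{s,s+n+1}(t) F(0) = ∫_0^t S_s(t-τ) C^{gc,out}_{s,s+1} [Q_{s+1,s+1+n}(τ) F(0)] dτ`. [folklore] -/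
theorem lanfordGCTerm_succ (f₀ : UnitAddTorus d × EuclideanSpace ℝ d → ℝ) (n s : ℕ) (t : ℝ) (Z : Config s d (UnitAddTorus d)) :
    lanfordGCTerm (d := d) hε' f₀ (n + 1) s t Z =
      ∫ τ in (0 : ℝ)..t, (gcHierarchyModel (d := d) hε').transport s (t - τ)
        ((gcHierarchyModel hε').op s (lanfordGCTerm hε' f₀ n (s + 1) τ)) Z :=
  duhamelTerm_succ _ _ n s t _ Z

variable {β₀ C₀ : ℝ} {f₀ : UnitAddTorus d × EuclideanSpace ℝ d → ℝ}

/-- **The Duhamel terms are measurable** (indeed nice in time: `isNiceT_duhamelTerm` for the nice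
data `isNice_lanfordGCData`), `0 ≤ ε`, `t ≥ 0`. [folklore] -/
theorem measurable_lanfordGCTerm (hε : 0 ≤ ε) (hβ₀ : 0 < β₀) (hf₀m : Measurable f₀)
    (hf₀ : 0 ≤ f₀) (hf₀b : ∀ z, f₀ z ≤ C₀ * exp (-(β₀ / 2) * ‖z.2‖ ^ 2)) (n s : ℕ) {t : ℝ}
    (ht : 0 ≤ t) : Measurable (lanfordGCTerm (d := d) hε' f₀ n s t) :=
  (isNice_duhamelTerm (gcHierarchyModel hε') (isNice_lanfordGCData hε hβ₀ hf₀m hf₀ hf₀b) n s ht).1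

/-- The Duhamel terms vanish off the hard-sphere domains. [folklore] -/
theorem lanfordGCTerm_eq_zero_of_not_mem (hε : 0 ≤ ε) (hβ₀ : 0 < β₀) (hf₀m : Measurable f₀)
    (hf₀ : 0 ≤ f₀) (hf₀b : ∀ z, f₀ z ≤ C₀ * exp (-(β₀ / 2) * ‖z.2‖ ^ 2)) (n s : ℕ) (t : ℝ)
    {Z : Config s d (UnitAddTorus d)} (hZ : Z ∉ hardSphereDomain (Torus.geometry d) s ε) :
    lanfordGCTerm (d := d) hε' f₀ n s t Z = 0 :=
  duhamelTerm_gcHierarchyModel_eq_zero_of_not_mem hε'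
    (fun k _ hW => lanfordGCData_eq_zero_of_not_mem hε hβ₀ hf₀m hf₀ hf₀b k hW) n s t Z hZ

/-- The data bound with the enlarged constant `N = max (C₀, 1)`:
`|F^{(k)}_ε(0)| ≤ N^k e^{-β₀ E}`. [folklore] -/
theorem abs_lanfordGCData_le_max_pow (hε : 0 ≤ ε) (hβ₀ : 0 < β₀) (hC₀ : 0 ≤ C₀) (hf₀m : Measurable f₀)
    (hf₀ : 0 ≤ f₀) (hf₀b : ∀ z, f₀ z ≤ C₀ * exp (-(β₀ / 2) * ‖z.2‖ ^ 2)) (k : ℕ) (W : Config k d (UnitAddTorus d)) :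
    |lanfordGCData (d := d) ε f₀ k W| ≤ max C₀ 1 ^ k * exp (-β₀ * configEnergy W) := by
  obtain ⟨-, hb⟩ := lanfordGCData_nice hε hβ₀ hf₀m hf₀ hf₀b k
  rw [abs_of_nonneg (hb W).1]
  exact (hb W).2.trans
    (mul_le_mul_of_nonneg_right (pow_le_pow_left₀ hC₀ (le_max_left _ _) k) (exp_pos _).le)

/-- **The chain estimate for the Duhamel terms of order `n ≥ 1`** (CIP 1994 (4.17)–(4.18); BGSR
Lemma 4.2): `|Q^ε_{s,s+n}(t) F_ε(0) (Z_s)| ≤ e^{s-1} (C'_d t/(√β₀)^{d+1})ⁿ N^{s+n} e^{-(β₀/2) E(Z_s)}`,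
`N = max (C₀, 1)`, `C'_d = e² (√2)^{d+3} C_d + 1` (`abs_hierarchyChain_le` for the model with the
innermost bound `abs_lanfordGCData_le_max_pow`, the regularised flow preserving the energy).
[cite: CIP1994, §4.4 Thm 4.4.1, proof, Step 3, (4.17)–(4.18), pp. 84–85] -/
theorem abs_lanfordGCTerm_le_chain (hε : 0 ≤ ε) (hβ₀ : 0 < β₀) (hC₀ : 0 ≤ C₀) (hf₀m : Measurable f₀)
    (hf₀ : 0 ≤ f₀) (hf₀b : ∀ z, f₀ z ≤ C₀ * exp (-(β₀ / 2) * ‖z.2‖ ^ 2)) (s n : ℕ) (hn : 1 ≤ n)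
    {t : ℝ} (ht : 0 ≤ t) (Z : Config s d (UnitAddTorus d)) :
    |lanfordGCTerm (d := d) hε' f₀ n s t Z| ≤
      exp (s - 1) * ((exp 2 * sqrt 2 ^ (Fintype.card d + 3) * (gcHierarchyModel (d := d) hε').opConst + 1) *
          t / sqrt β₀ ^ (Fintype.card d + 1)) ^ n * max C₀ 1 ^ (s + n) *
        exp (-(β₀ / 2) * configEnergy Z) := by
  have hB : 0 ≤ max C₀ 1 ^ (s + n) := by positivity
  refine abs_hierarchyChain_le (gcHierarchyModel (d := d) hε') (fun n k τ => lanfordGCTerm (d := d) hε' f₀ n k τ)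
    (fun n k τ W => lanfordGCTerm_succ hε' f₀ n k τ W) ht hβ₀ s n hn hB ?_ ⟨ht, le_rfl⟩ Z
  intro τ _ W
  have h := abs_lanfordGCData_le_max_pow hε hβ₀ hC₀ hf₀m hf₀ hf₀b (s + n)
    (Alexander.regFlow (Torus.geometry d) ε (-τ) W)
  rw [Alexander.configEnergy_regFlow] at h
  exact h

/-- **Uniform a priori bound on the Duhamel terms of the grand-canonical BBGKY hierarchy**
(CIP 1994 Thm 4.4.1, proof, Step 3, (4.16)–(4.18); GST 2013 Thm 6). Let
`0 ≤ f₀ ≤ C₀ e^{-β₀|v|²/2}` be measurable, `N = max (C₀, 1)`, and let `t ≥ 0` satisfy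
`2 C'_d N t ≤ (√β₀)^{d+1}` with `C'_d = e² (√2)^{d+3} C_d + 1` the chain constant of the model
(`C_d = gcHierarchyModel.opConst`, independent of `ε`). Then for all `s, n, Z_s`
`|Q^ε_{s,s+n}(t) F_ε(0) (Z_s)| ≤ (1 + e^{s-1}) N^s 2^{-n} e^{-(β₀/2) E(Z_s)}` — uniformly in
`ε ∈ [0, 1/2)`. Proof: the order-`0` term is the datum transported by an energy-preserving map;
for `n ≥ 1`, `abs_lanfordGCTerm_le_chain` and `C'_d N t/(√β₀)^{d+1} ≤ 1/2`.
[cite: CIP1994, §4.4 Thm 4.4.1, proof, Step 3, (4.16)–(4.18), pp. 83–85] -/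
theorem abs_lanfordGCTerm_le (hε : 0 ≤ ε) (hβ₀ : 0 < β₀) (hC₀ : 0 ≤ C₀) (hf₀m : Measurable f₀)
    (hf₀ : 0 ≤ f₀) (hf₀b : ∀ z, f₀ z ≤ C₀ * exp (-(β₀ / 2) * ‖z.2‖ ^ 2)) {t : ℝ} (ht : 0 ≤ t)
    (hsmall : 2 * (exp 2 * sqrt 2 ^ (Fintype.card d + 3) * (gcHierarchyModel (d := d) hε').opConst + 1) *
      max C₀ 1 * t ≤ sqrt β₀ ^ (Fintype.card d + 1))
    (n s : ℕ) (Z : Config s d (UnitAddTorus d)) :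
    |lanfordGCTerm (d := d) hε' f₀ n s t Z| ≤
      (1 + exp (s - 1)) * max C₀ 1 ^ s * (2⁻¹ : ℝ) ^ n * exp (-(β₀ / 2) * configEnergy Z) := by
  -- constants
  obtain ⟨N₁, hN₁⟩ : ∃ N₁ : ℝ, N₁ = max C₀ 1 := ⟨_, rfl⟩
  have hN₁1 : 1 ≤ N₁ := by rw [hN₁]; exact le_max_right _ _
  have hN₁0 : 0 < N₁ := lt_of_lt_of_le one_pos hN₁1
  obtain ⟨Cst, hCst⟩ : ∃ Cst : ℝ,
      Cst = exp 2 * sqrt 2 ^ (Fintype.card d + 3) * (gcHierarchyModel (d := d) hε').opConst + 1 :=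
    ⟨_, rfl⟩
  have hCst0 : 0 < Cst := by
    have := (gcHierarchyModel (d := d) hε').opConst_nonneg
    rw [hCst]; positivity
  have hsβ : 0 < sqrt β₀ ^ (Fintype.card d + 1) := pow_pos (sqrt_pos.2 hβ₀) _
  rw [← hN₁, ← hCst] at hsmall
  rw [← hN₁]
  have hE0 : 0 ≤ configEnergy Z := configEnergy_nonneg' Z
  have hE2 : exp (-β₀ * configEnergy Z) ≤ exp (-(β₀ / 2) * configEnergy Z) :=
    exp_le_exp.2 (by nlinarith)
  rcases Nat.eq_zero_or_pos n with rfl | hn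
  · -- order `0`: the transported datum
    rw [pow_zero, mul_one, lanfordGCTerm_zero]
    have h := abs_lanfordGCData_le_max_pow hε hβ₀ hC₀ hf₀m hf₀ hf₀b s
      (Alexander.regFlow (Torus.geometry d) ε (-t) Z)
    rw [Alexander.configEnergy_regFlow, ← hN₁] at h
    calc |lanfordGCData ε f₀ s (Alexander.regFlow (Torus.geometry d) ε (-t) Z)|
        ≤ N₁ ^ s * exp (-β₀ * configEnergy Z) := h
      _ ≤ N₁ ^ s * exp (-(β₀ / 2) * configEnergy Z) := mul_le_mul_of_nonneg_left hE2 (by positivity)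
      _ ≤ (1 + exp (s - 1)) * N₁ ^ s * exp (-(β₀ / 2) * configEnergy Z) := by
          have h1 : N₁ ^ s ≤ (1 + exp (s - 1)) * N₁ ^ s := by
            have : 0 ≤ exp (s - 1 : ℝ) * N₁ ^ s := by positivity
            nlinarith
          exact mul_le_mul_of_nonneg_right h1 (exp_pos _).le
  · -- order `n ≥ 1`: the chain estimate
    have h := abs_lanfordGCTerm_le_chain hε' hε hβ₀ hC₀ hf₀m hf₀ hf₀b s n hn ht Z
    rw [← hN₁, ← hCst] at h
    refine h.trans ?_
    obtain ⟨r, hr⟩ : ∃ r : ℝ, r = Cst * t / sqrt β₀ ^ (Fintype.card d + 1) * N₁ := ⟨_, rfl⟩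
    have hr0 : 0 ≤ r := by rw [hr]; positivity
    have hr2 : r ≤ 2⁻¹ := by
      rw [hr, div_mul_eq_mul_div, div_le_iff₀ hsβ]
      nlinarith [hsmall]
    have hconv : exp (s - 1) * (Cst * t / sqrt β₀ ^ (Fintype.card d + 1)) ^ n * N₁ ^ (s + n) =
        exp (s - 1) * N₁ ^ s * r ^ n := by
      rw [hr, pow_add, mul_pow]
      ring
    calc exp (s - 1) * (Cst * t / sqrt β₀ ^ (Fintype.card d + 1)) ^ n * N₁ ^ (s + n) *
          exp (-(β₀ / 2) * configEnergy Z)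
        = exp (s - 1) * N₁ ^ s * r ^ n * exp (-(β₀ / 2) * configEnergy Z) := by rw [hconv]
      _ ≤ exp (s - 1) * N₁ ^ s * (2⁻¹ : ℝ) ^ n * exp (-(β₀ / 2) * configEnergy Z) := by
          gcongr
      _ ≤ (1 + exp (s - 1)) * N₁ ^ s * (2⁻¹ : ℝ) ^ n * exp (-(β₀ / 2) * configEnergy Z) := by
          have h1 : exp (s - 1 : ℝ) * N₁ ^ s ≤ (1 + exp (s - 1)) * N₁ ^ s := by
            have : 0 ≤ N₁ ^ s := by positivity
            nlinarith
          gcongr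

/-- **The BBGKY-side majorants of Lanford's theorem, packaged** (clauses "measurable" and
"majorants" of the hypothesis of `lanford_of_bbgkySide`, for the candidate terms `lanfordGCTerm`):
for `β₀ > 0`, `C₀ > 0` there is a time `T_B = (√β₀)^{d+1} / (2 C'_d max(C₀, 1)) > 0`, depending on
`(d, β₀, C₀)` only, such that for EVERY diameter `ε ∈ (0, 1/2)` and every Lanford datum `f₀`
(`IsLanfordDatum β₀ C₀ f₀`, curried as in `lanford`), the Duhamel terms of the grand-canonical BBGKY
hierarchy with data the initial correlation functions of `gcInitial ε μ_ε (uncurry f₀)` are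
measurable and obey `|Q^ε_{s,s+n}(t) F_ε(0)| ≤ M_s 2^{-n} e^{-(β₀/2) E}` on `[0, T_B]`,
`M_s = (1 + e^{s-1}) max(C₀,1)^s` (CIP 1994 Thm 4.4.1 Step 3; GST 2013 Thm 6).
[cite: CIP1994, §4.4 Thm 4.4.1, proof, Step 3, pp. 83–85] -/
theorem exists_time_forall_abs_lanfordGCTerm_le {β₀ C₀ : ℝ} (hβ₀ : 0 < β₀) (hC₀ : 0 < C₀) :
    ∃ T_B > (0 : ℝ), ∀ {ε : ℝ} (_hε : 0 < ε) (hε' : ε < 2⁻¹) (f₀ : UnitAddTorus d → EuclideanSpace ℝ d → ℝ), IsLanfordDatum β₀ C₀ f₀ →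
      (∀ n s, ∀ t ∈ Icc 0 T_B, Measurable (lanfordGCTerm (d := d) hε' (uncurry f₀) n s t)) ∧
      (∀ n s, ∀ t ∈ Icc 0 T_B, ∀ Z : Config s d (UnitAddTorus d), |lanfordGCTerm (d := d) hε' (uncurry f₀) n s t Z| ≤
        (1 + exp (s - 1)) * max C₀ 1 ^ s * (2⁻¹ : ℝ) ^ n * exp (-(β₀ / 2) * configEnergy Z)) := by
  haveI := isFiniteMeasure_sphereMeasure (E := EuclideanSpace ℝ d)
  obtain ⟨Cd, hCd⟩ : ∃ Cd : ℝ, Cd = (∫ u : EuclideanSpace ℝ d, (1 + ‖u‖) * exp (-(1 / 2) * ‖u‖ ^ 2)) *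
      (KineticTheory.sphereMeasure : Measure (sphere (0 : EuclideanSpace ℝ d) 1)).real univ := ⟨_, rfl⟩
  have hJ : 0 ≤ ∫ u : EuclideanSpace ℝ d, (1 + ‖u‖) * exp (-(1 / 2) * ‖u‖ ^ 2) := integral_nonneg fun u => by positivity
  have hCd0 : 0 ≤ Cd := by rw [hCd]; exact mul_nonneg hJ measureReal_nonneg
  obtain ⟨Cst, hCst⟩ : ∃ Cst : ℝ, Cst = exp 2 * sqrt 2 ^ (Fintype.card d + 3) * Cd + 1 := ⟨_, rfl⟩
  have hCst0 : 0 < Cst := by rw [hCst]; positivity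
  obtain ⟨N₁, hN₁⟩ : ∃ N₁ : ℝ, N₁ = max C₀ 1 := ⟨_, rfl⟩
  have hN₁0 : 0 < N₁ := by rw [hN₁]; exact lt_of_lt_of_le one_pos (le_max_right _ _)
  have hsβ : 0 < sqrt β₀ ^ (Fintype.card d + 1) := pow_pos (sqrt_pos.2 hβ₀) _
  refine ⟨sqrt β₀ ^ (Fintype.card d + 1) / (2 * Cst * N₁), by positivity, fun hε hε' f₀ hf₀ => ?_⟩
  -- the uncurried datum
  have hf₀c : Continuous (uncurry f₀) := hf₀.2.1.1
  have hf₀m : Measurable (uncurry f₀) := hf₀c.measurable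
  have hf₀0 : 0 ≤ uncurry f₀ := fun z => hf₀.1 z.1 z.2
  have hf₀b : ∀ z : UnitAddTorus d × EuclideanSpace ℝ d, uncurry f₀ z ≤ C₀ * exp (-(β₀ / 2) * ‖z.2‖ ^ 2) := fun z =>
    (le_abs_self _).trans (abs_le_of_eGaussSupNorm_le hC₀.le hf₀.2.2 z.1 z.2)
  refine ⟨fun n s t ht => measurable_lanfordGCTerm hε' hε.le hβ₀ hf₀m hf₀0 hf₀b n s ht.1,
    fun n s t ht Z => ?_⟩
  have hopc : (gcHierarchyModel (d := d) hε').opConst = Cd := by rw [hCd]; rfl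
  have hsmall : 2 * (exp 2 * sqrt 2 ^ (Fintype.card d + 3) * (gcHierarchyModel (d := d) hε').opConst + 1) *
      max C₀ 1 * t ≤ sqrt β₀ ^ (Fintype.card d + 1) := by
    rw [hopc, ← hCst, ← hN₁]
    have h2 : 0 < 2 * Cst * N₁ := by positivity
    calc 2 * Cst * N₁ * t ≤ 2 * Cst * N₁ * (sqrt β₀ ^ (Fintype.card d + 1) / (2 * Cst * N₁)) := by
          gcongr; exact ht.2
      _ = sqrt β₀ ^ (Fintype.card d + 1) := by field_simp
  exact abs_lanfordGCTerm_le hε' hε.le hβ₀ hC₀.le hf₀m hf₀0 hf₀b ht.1 hsmall n s Z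

end Terms

end

end Literature.MathematicalPhysics.KineticTheory
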